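import Summits.BirchSwinnertonDyer.Rank1Residual.Partition.MainConjecturesCoveredAllPrimesJetchev
import Summits.BirchSwinnertonDyer.Rank1Residual.GaloisImage.IsogenySurjTransport
import Literature.NumberTheory.EllipticCurves.BSDSelmerCMPConverseMaximalOrderProofs
import HarnessLib

/-!
# Rows C2, C16 and C3-ordinary FROM PUBLISHED NAMED FACTS with the Tamagawa proviso READ ON THE
# OPTIMAL CURVE OF THE ISOGENY CLASS: no optimality demand on `E` itself (cell `b2b-bsdres`, GLUE seat
# gen 8; companion of `MainConjecturesTamagawaJetchevRows.lean` / `MainConjecturesCoveredAllPrimesJetchev.lean`)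

HONEST FRAMING (cell `b2b-bsdres`, run/shared/lean/b2b/bsd-rank1-residual/, verbatim in every
file): the goal of the cell is to DELETE the COMBINATION-SHAPED residual classes of the
Birch–Swinnerton-Dyer formula for ALL analytic-rank `≤ 1` elliptic curves over `ℚ` — "full BSD
formula for every rank `≤ 1` curve in class `C`" assembled STRICTLY from published theorems — so
that the rank-`≤ 1` remainder becomes exactly the CONSTRUCTION-SHAPED classes, which are TYPED
(missing-input `Prop`s), NOT attempted. This is not "finishing BSD". Research routes; no claim
beyond the stated classes; nothing booked; no label changes. THEOREMS ONLY (no definition, no named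
fact, no `sorry`); every published theorem enters as one of the tree's existing named Literature
facts BY NAME; every unproved / untyped-in-Literature statement enters as an EXPLICIT binder.

## What this file records

`MainConjecturesTamagawaJetchevRows.lean` relaxed the Tamagawa proviso of the irreducible rank-one
rows to "`p ∤ ∏c_ℓ(E)`, or `E` OPTIMAL (`hopt`) with the `p`-divisibility of its Tamagawa numbers at
one bad prime (`htam1`)". Here the optimality demand on `E` is REMOVED: `BSD(E,p)` is an isogeny
invariant (Cassels; tree theorem `Additive.TwistComparison.bsdp_of_bsdp_of_isIsogenous` from the named
fact `bsdRHS_eq_of_isIsogenous`), every globally minimal `E` is `ℚ`-isogenous to a globally minimal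
`E₀` of the same conductor carrying an optimal parametrisation datum
(`exists_isIsogenous_optimalDatum_of_modularity`: modularity + Edixhoven 1991 Prop. 2 + Knapp
Prop. 12.9 (a), tree theorems), and the Jetchev chain needs of `E₀` only `r_an(E₀) = 1`, good
ordinary reduction and `ρ̄_{E₀,p}` onto — all three ISOGENY INVARIANTS in the tree
(`analyticRank_eq_of_isIsogenous'`; `IsIsogenous.hasGoodReductionAtPrime_iff`,
`IsIsogenous.not_dvd_frobeniusTrace_iff` (Néron–Ogg–Shafarevich, Faltings); and
`GaloisImage.surj_iff_of_isIsogenous_of_irr` (an isogeny not killing `E[p]` is an equivariant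
isomorphism on `E[p]` when `E[p]` is irreducible)). So the residual Tamagawa binder becomes

* `htam1 : r = 1 → p ∣ ∏c_ℓ(E) → ∀ E₀ ∼ E globally minimal with an optimal datum at N_{E₀},
   p ∣ ∏c_ℓ(E₀) → ∃ q ∣ N_{E₀} prime, ord_p ∏_ℓ c_ℓ(E₀) ≤ ord_p c_q(E₀)`

("if `p` divides a Tamagawa number of `E`, then on the optimal curve `E₀` of its class the
`p`-divisibility of the Tamagawa numbers is concentrated at one bad prime — or absent"): vacuous off
`p ∣ ∏c_ℓ(E)`, and read per isogeny class on the optimal curve — EXACTLY the convention of the cell's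
census (VALUE-TABLE.md caption: "Cremona's OPTIMAL curves of analytic rank ≤ 1, one per isogeny
class"). What is NOT reached (said plainly): `p ∣ c_ℓ(E₀)` at two or more bad primes of the optimal
curve — Jetchev–Skinner–Wan §7.4.2's `K″`/`X_{N⁺,N⁻}` argument (the tree lacks that currency).

| theorem | content |
|---|---|
| `bsdp_rankOne_of_thm331_of_columnMainConjecture_odd_of_kolyvaginOrJetchev` | gen 6's generic rank-one theorem (JSW 3.3.1 control) and this gen's Jetchev twin MERGED: Kolyvagin's bound off `p ∣ ∏c_ℓ`, Jetchev's on it (`hopt`/`htam1` as implications from `p ∣ ∏c_ℓ`) |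
| `RowC2.bsdp_of_publishedFacts_of_jetchev_optimalCurve` | row C2 (`r ≤ 1`), Tamagawa binder read on the optimal curve |
| `RowC16.bsdp_of_publishedFacts_of_jetchev_optimalCurve` | row C16 (`r ≤ 1`, `p = 3`), same |
| `RowC3.bsdp_of_publishedFacts_of_kobayashiMainConjecture_of_jetchev_optimalCurve` | row C3, ordinary branch same; supersingular branch `hKMC` (unchanged) |

References: [Jetchev2008] Cor. 1.5 (p. 3); [JetchevSkinnerWan2017] §1 (p. 4), §7.4.2 (p. 31);
[Cassels1965ArithmeticVIII]; [MilneADT2006] Thm. I.7.3; [EdixhovenManin1991] Prop. 2; [Knapp1993]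
Prop. 12.9 (a); [SilvermanAEC2009] Cor. VII.7.2; [Miller2011LMS] Def. 1.1; HOME/b2b-bsdres-lit-glue/
GLUE.md GEN 8 ADDENDUM (§G8.8).
-/

set_option autoImplicit false

noncomputable section

open scoped Classical

open CongruenceSubgroup WeierstrassCurve NumberField IsDedekindDomain
  Literature.NumberTheory.EllipticCurves Literature.NumberTheory.Automorphic
  Literature.NumberTheory.EllipticCurves.ModularForms
  Literature.NumberTheory.EllipticCurves.Rank1Residual
  Literature.NumberTheory.EllipticCurves.Rank1Residual.Typed
  Literature.NumberTheory.EllipticCurves.CastellaGrossiLeeSkinner2022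
  Literature.NumberTheory.EllipticCurves.BurungaleCastellaSkinner2025
  Literature.NumberTheory.EllipticCurves.YanZhu2026
  Literature.NumberTheory.EllipticCurves.BurungaleKobayashiOta2024
  Literature.NumberTheory.EllipticCurves.JetchevSkinnerWan2017
  Summit.BirchSwinnertonDyer.BirchSwinnertonDyer.Theorems.Rank1ResidualX1Defs

namespace Summit.BirchSwinnertonDyer.Rank1Residual

/-! ### §1 Kolyvagin off `p ∣ ∏c_ℓ`, Jetchev on it: the merged generic rank-one theorem -/

/-- **Rank one, generic odd prime `p ≥ 3`, anomalous or not — Kolyvagin's bound off `p ∣ ∏c_ℓ`,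
Jetchev's bound on it.** The column's typed cyclotomic main conjecture (`hMC`, `hIm`) + JSW 2017
Thm. 3.3.1 (`h331`) + the anticyclotomic IMC ∘ BDP in JSW's letter (`hLA`) + (irred_𝒦) (`hIrrK`) ⇒
`BSD(E,p)` for a pair `p ≥ 3` good ordinary, `ρ̄` onto, `r_an = 1`: by gen 6's
`bsdp_rankOne_of_thm331_of_columnMainConjecture_odd` (Kolyvagin `hB`) when `p ∤ ∏c_ℓ(E)`, by this
gen's `…_of_jetchev` (Jetchev 2008 Cor. 1.5 `hJ`) when `p ∣ ∏c_ℓ(E)`, the optimality datum `hopt` and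
the one-prime concentration `htam1` being asked only then. [cite: Jetchev2008, Cor. 1.5 (p. 3)]
[cite: JetchevSkinnerWan2017, Thm. 3.3.1, §7.4.1–7.4.2 (pp. 30–31)] [cite: McCallumLMS1991, §1]
[cite: Miller2011LMS, Def. 1.1] -/
theorem bsdp_rankOne_of_thm331_of_columnMainConjecture_odd_of_kolyvaginOrJetchev
    (hGZ : ∀ (N : ℕ) [NeZero N] (W : WeierstrassCurve ℚ) (K : Type) [Field K] [NumberField K],
      gross_zagier N W K)
    (hKo : ∀ (N : ℕ) [NeZero N] (W : WeierstrassCurve ℚ) (K : Type) [Field K] [NumberField K],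
      kolyvagin N W K)
    (hB : ∀ (N : ℕ) [NeZero N] (W : WeierstrassCurve ℚ) (K : Type) [Field K] [NumberField K],
      Kolyvagin1990_padicValNat_card_sha_le N W K)
    (hJ : Jetchev2008.cor15_padicValNat_card_primaryComponent_sha_le)
    (h331 : thm331_anticyclotomicControl)
    (hGr : greenberg_charValue_rankZero) (hGZK : rank_eq_analyticRank_of_analyticRank_le_one)
    (hmod : hasEntireLFunction_rat) (hpar : nonempty_modularParametrizationData)
    (hnf : exists_isNewformOf) (hHL : HoffsteinLuo1997_exists_twist_L_one_ne_zero)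
    (hMaz : mazur_not_dvd_maninConstant_of_odd) (hNS : integral_neronScaling_of_isGloballyMinimal)
    (W : WeierstrassCurve ℚ) [W.IsElliptic] [W.IsGloballyMinimal] (p : ℕ) [Fact p.Prime]
    (hp3 : 3 ≤ p) (hord : GoodOrd W p) (hsurj : Surj W p) (hr : W.analyticRank = 1)
    (hopt : p ∣ W.tamagawaProduct → ∀ (N : ℕ) [NeZero N], W.conductorNorm ℤ = N →
      ∃ Dt : ModularParametrizationData W N,
        ∀ z ∈ Dt.L.lattice, ∃ w ∈ periodLattice Dt.f, z = (Dt.c : ℂ) * w)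
    (htam1 : p ∣ W.tamagawaProduct → ∃ (q : ℕ) (_ : Fact q.Prime), q ∣ W.conductorNorm ℤ ∧
      padicValNat p W.tamagawaProduct ≤ padicValNat p ((W.baseChange ℚ_[q]).localTamagawaNumber ℤ_[q]))
    (hMC : ∀ (V : WeierstrassCurve ℚ) [V.IsElliptic] [V.IsGloballyMinimal],
      GoodOrd V p → Irr V p → BigIm V p → MazurMainConjecture V p)
    (hIm : ∀ (V : WeierstrassCurve ℚ) [V.IsElliptic] [V.IsGloballyMinimal],
      GoodOrd V p → Surj V p → BigIm V p)
    (hIrrK : ∀ (K : Type) [Field K] [NumberField K], IsImaginaryQuadratic K →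
      SatisfiesHeegnerHypothesis (W.conductorNorm ℤ) K → SatisfiesHeegnerHypothesis p K →
      (W.baseChange K).HasIrreducibleModPGaloisRep p)
    (hLA : ∀ (N : ℕ) [NeZero N] (K : Type) [Field K] [NumberField K]
      (Dt : ModularParametrizationData W N) (H : HeegnerDatum N (NumberField.discr K)) (ιC : K →+* ℂ)
      (P : (W.baseChange K).toAffine.Point),
      W.conductorNorm ℤ = N → IsImaginaryQuadratic K → Odd (NumberField.discr K) →
      NumberField.discr K < -4 → SatisfiesHeegnerHypothesis N K → SatisfiesHeegnerHypothesis p K →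
      (W.quadraticTwist (NumberField.discr K : ℚ)).entireLFunction 1 ≠ 0 →
      WeierstrassCurve.Affine.Point.map ιC.toRatAlgHom P = heegnerPointComplex Dt H →
      ¬ (p : ℤ) ∣ Dt.c → ¬ IsOfFinAddOrder P →
      ∀ (κ : ZpExtension K p), κ.IsAnticyclotomic →
        ∀ (γ : Field.absoluteGaloisGroup K) [Fact (κ.IsTopGenerator γ)] (ι : K →+* ℚ_[p]),
          X11b.IMCLowerWaldspurgerOnTreeGoodAt p κ (X11b.inducedPlace ι) γ ι P) :
    BSDp W p := by
  by_cases htp : p ∣ W.tamagawaProduct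
  · exact bsdp_rankOne_of_thm331_of_columnMainConjecture_odd_of_jetchev hGZ hKo hJ h331 hGr hGZK hmod
      hpar hnf hHL hMaz hNS W p hp3 hord hsurj hr (hopt htp) (htam1 htp) hMC hIm hIrrK hLA
  · exact bsdp_rankOne_of_thm331_of_columnMainConjecture_odd hGZ hKo hB h331 hGr hGZK hmod hpar hnf hHL
      hMaz hNS W p hp3 hord hsurj hr htp hMC hIm hIrrK hLA

/-! ### §2 The rows, Tamagawa binder read on the optimal curve of the class -/

section Rows

variable (W : WeierstrassCurve ℚ) [W.IsElliptic] [W.IsGloballyMinimal] (p : ℕ) [Fact p.Prime]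

/-- **Row C2 (`r ≤ 1`) FROM PUBLISHED NAMED FACTS, Tamagawa binder read on the OPTIMAL CURVE of the
class.** Off `p ∣ ∏c_ℓ(E)`: gen 7's `RowC2.bsdp_of_publishedFacts`. On `r = 1 ∧ p ∣ ∏c_ℓ(E)`: pass to
the optimal curve `E₀ ∼ E` (`exists_isIsogenous_optimalDatum_of_modularity`); `r_an`, good ordinary
reduction and surjectivity of `ρ̄_{·,p}` transfer along the isogeny (tree theorems); §1 closes
`BSD(E₀,p)` — Kolyvagin if `p ∤ ∏c_ℓ(E₀)`, Jetchev 2008 Cor. 1.5 with `htam1` if `p ∣ ∏c_ℓ(E₀)` —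
with BCS 1.1.2 (b), JSW 3.3.1, BCS 1.2.4 (b) ∘ CGLS 5.1.3, (irred_𝒦) ⇐ (sur), (im) ⇐ (sur); then
Cassels' isogeny invariance (`hCassels`) returns to `E`. [cite: Jetchev2008, Cor. 1.5 (p. 3)]
[cite: BurungaleCastellaSkinner2025, Thm. 1.1.2 (b), Thm. 1.2.4 (b), Cor. 1.3.1]
[cite: JetchevSkinnerWan2017, Thm. 3.3.1, §7.4.2 (p. 31)] [cite: MilneADT2006, Thm. I.7.3]
[cite: EdixhovenManin1991, Prop. 2] [cite: Miller2011LMS, Def. 1.1] -/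
theorem RowC2.bsdp_of_publishedFacts_of_jetchev_optimalCurve
    (hGZ : ∀ (N : ℕ) [NeZero N] (W : WeierstrassCurve ℚ) (K : Type) [Field K] [NumberField K],
      gross_zagier N W K)
    (hKo : ∀ (N : ℕ) [NeZero N] (W : WeierstrassCurve ℚ) (K : Type) [Field K] [NumberField K],
      kolyvagin N W K)
    (hB : ∀ (N : ℕ) [NeZero N] (W : WeierstrassCurve ℚ) (K : Type) [Field K] [NumberField K],
      Kolyvagin1990_padicValNat_card_sha_le N W K)
    (hJ : Jetchev2008.cor15_padicValNat_card_primaryComponent_sha_le)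
    (hBCS : thm112b_charIdeal_eq_padicLFunction_integral) (h331 : thm331_anticyclotomicControl)
    (h124 : thm124b_thm513_generator_constantCoeff)
    (hGr : greenberg_charValue_rankZero) (hGZK : rank_eq_analyticRank_of_analyticRank_le_one)
    (hmod : hasEntireLFunction_rat) (hpar : nonempty_modularParametrizationData)
    (hnf : exists_isNewformOf) (hHL : HoffsteinLuo1997_exists_twist_L_one_ne_zero)
    (hMaz : mazur_not_dvd_maninConstant_of_odd) (hNS : integral_neronScaling_of_isGloballyMinimal)
    (hCassels : bsdRHS_eq_of_isIsogenous)
    (h : RowC2 W p) (hr : W.analyticRank ≤ 1)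
    (htam1 : W.analyticRank = 1 → p ∣ W.tamagawaProduct →
      ∀ (W₀ : WeierstrassCurve ℚ) [W₀.IsElliptic] [W₀.IsGloballyMinimal], W.IsIsogenous W₀ →
        (∀ (N : ℕ) [NeZero N], W₀.conductorNorm ℤ = N →
          ∃ Dt : ModularParametrizationData W₀ N,
            ∀ z ∈ Dt.L.lattice, ∃ w ∈ periodLattice Dt.f, z = (Dt.c : ℂ) * w) →
        p ∣ W₀.tamagawaProduct → ∃ (q : ℕ) (_ : Fact q.Prime), q ∣ W₀.conductorNorm ℤ ∧
          padicValNat p W₀.tamagawaProduct ≤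
            padicValNat p ((W₀.baseChange ℚ_[q]).localTamagawaNumber ℤ_[q])) :
    BSDp W p := by
  by_cases htp : p ∣ W.tamagawaProduct
  · have hp : 3 < p := h.2.1
    have hp5 : 5 ≤ p := (Fact.out : p.Prime).five_le_of_ne_two_of_ne_three (by omega) (by omega)
    have hsurj : Surj W p := surj_of_irr_of_bigIm W p h.2.2.2.1 h.2.2.2.2
    rcases Nat.lt_or_ge W.analyticRank 1 with h0 | h1
    · exact RowC2.bsdp_rankZero_of_bcsThm112b hBCS hGr hpar hGZK h (by omega)
    · have hr1 : W.analyticRank = 1 := le_antisymm hr h1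
      -- the optimal curve of the class and the transfers
      obtain ⟨W₀, hW₀e, hW₀m, hiso, -, hopt₀⟩ := exists_isIsogenous_optimalDatum_of_modularity hnf W
      haveI := hW₀e
      haveI := hW₀m
      have hr₀ : W₀.analyticRank = 1 := by rw [← analyticRank_eq_of_isIsogenous' hiso, hr1]
      have hgood₀ : Good W₀ p := (hiso.hasGoodReductionAtPrime_iff p).mp h.2.2.1.1
      have hord₀ : GoodOrd W₀ p :=
        ⟨hgood₀, (hiso.not_dvd_frobeniusTrace_iff p h.2.2.1.1).mp h.2.2.1.2⟩
      have hsurj₀ : Surj W₀ p := (GaloisImage.surj_iff_of_isIsogenous_of_irr hiso h.2.2.2.1).mp hsurj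
      have hB₀ : BSDp W₀ p := by
        refine bsdp_rankOne_of_thm331_of_columnMainConjecture_odd_of_kolyvaginOrJetchev hGZ hKo hB hJ
          h331 hGr hGZK hmod hpar hnf hHL hMaz hNS W₀ p (by omega) hord₀ hsurj₀ hr₀ (fun _ ↦ hopt₀)
          (fun htp₀ ↦ htam1 hr1 htp W₀ hiso hopt₀ htp₀)
          (fun V _ _ hordV hirrV himV ↦ hBCS V p hp hordV hirrV himV)
          (fun V _ _ _ hsV ↦ X9.bigIm_of_surj V p hp5 hsV)
          (fun K _ _ hK _ _ ↦ irrK_of_surj W₀ p hsurj₀ K hK.1) ?_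
        intro N _ K _ _ Dt H ιC P hN hK hodd hlt hHN hHp _ hP hc hPinf κ hκ γ _ ι
        exact X11b.imcLowerWaldspurgerOnTreeGoodAt_inducedPlace_of_heegner_of_thm124b_of_thm331 W₀ p N
          K Dt H ιC P h124 h331 (hKo N W₀ K) hp hord₀ hsurj₀ (irrK_of_surj W₀ p hsurj₀ K hK.1) hN hK
          hodd hlt hHN hHp hP hc hPinf hκ ι
      exact Additive.TwistComparison.bsdp_of_bsdp_of_isIsogenous W₀ W p hCassels hGZK hmod
        hiso.symm_of_charZero hr₀.le hB₀
  · exact RowC2.bsdp_of_publishedFacts W p hGZ hKo hB hBCS h331 h124 hGr hGZK hmod hpar hnf hHL hMaz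
      hNS h hr fun _ ↦ htp

/-- **Row C16 (`r ≤ 1`: `p = 3` good ordinary, (irr), surj(3) ∨ ram(3)) FROM PUBLISHED NAMED FACTS,
Tamagawa binder read on the OPTIMAL CURVE of the class.** As for row C2, with Yan–Zhu 4.9 / 4.12 ∘
CGLS 5.1.3 at `p = 3`, (Im) at `3` from surj(3) (Wuthrich L. 20), ram(3) ⇒ surj(3); surj(3)
transfers to the optimal curve `E₀` (irreducible class), so §1 applies to `E₀`; Cassels returns to
`E`. [cite: Jetchev2008, Cor. 1.5 (p. 3)] [cite: YanZhu2024MainConjNonCM, Thm. 4.9, Thm. 4.12, Thm. 4.15 (§4.6)]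
[cite: JetchevSkinnerWan2017, Thm. 3.3.1, §7.4.2 (p. 31)] [cite: Wuthrich2014, Lemma 20 (p. 399)]
[cite: MilneADT2006, Thm. I.7.3] [cite: Miller2011LMS, Def. 1.1] -/
theorem RowC16.bsdp_of_publishedFacts_of_jetchev_optimalCurve
    (hGZ : ∀ (N : ℕ) [NeZero N] (W : WeierstrassCurve ℚ) (K : Type) [Field K] [NumberField K],
      gross_zagier N W K)
    (hKo : ∀ (N : ℕ) [NeZero N] (W : WeierstrassCurve ℚ) (K : Type) [Field K] [NumberField K],
      kolyvagin N W K)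
    (hB : ∀ (N : ℕ) [NeZero N] (W : WeierstrassCurve ℚ) (K : Type) [Field K] [NumberField K],
      Kolyvagin1990_padicValNat_card_sha_le N W K)
    (hJ : Jetchev2008.cor15_padicValNat_card_primaryComponent_sha_le)
    (hYZ : thm49_charIdeal_eq_padicLFunction_integral)
    (hW20 : Wuthrich2014.lemma20_surjective_threeAdic_of_semistable)
    (h331 : thm331_anticyclotomicControl) (h412 : thm412_thm513_generator_constantCoeff)
    (hGr : greenberg_charValue_rankZero) (hGZK : rank_eq_analyticRank_of_analyticRank_le_one)
    (hmod : hasEntireLFunction_rat) (hpar : nonempty_modularParametrizationData)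
    (hnf : exists_isNewformOf) (hHL : HoffsteinLuo1997_exists_twist_L_one_ne_zero)
    (hMaz : mazur_not_dvd_maninConstant_of_odd) (hNS : integral_neronScaling_of_isGloballyMinimal)
    (hCassels : bsdRHS_eq_of_isIsogenous)
    (h : RowC16 W p) (hr : W.analyticRank ≤ 1)
    (htam1 : W.analyticRank = 1 → p ∣ W.tamagawaProduct →
      ∀ (W₀ : WeierstrassCurve ℚ) [W₀.IsElliptic] [W₀.IsGloballyMinimal], W.IsIsogenous W₀ →
        (∀ (N : ℕ) [NeZero N], W₀.conductorNorm ℤ = N →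
          ∃ Dt : ModularParametrizationData W₀ N,
            ∀ z ∈ Dt.L.lattice, ∃ w ∈ periodLattice Dt.f, z = (Dt.c : ℂ) * w) →
        p ∣ W₀.tamagawaProduct → ∃ (q : ℕ) (_ : Fact q.Prime), q ∣ W₀.conductorNorm ℤ ∧
          padicValNat p W₀.tamagawaProduct ≤
            padicValNat p ((W₀.baseChange ℚ_[q]).localTamagawaNumber ℤ_[q])) :
    BSDp W p := by
  by_cases htp : p ∣ W.tamagawaProduct
  · rcases Nat.lt_or_ge W.analyticRank 1 with h0 | h1
    · exact RowC16.bsdp_rankZero_of_yzThm49 hYZ hW20 hGr hpar hGZK h (by omega)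
    · have hr1 : W.analyticRank = 1 := le_antisymm hr h1
      have htam11 := htam1 hr1 htp
      obtain ⟨hp3, hord, hirr, hsr⟩ := h
      have hsurj : Surj W p := hsr.elim id fun hram ↦ surj_of_irr_of_ram W p hirr hram
      subst hp3
      -- the optimal curve of the class and the transfers
      obtain ⟨W₀, hW₀e, hW₀m, hiso, -, hopt₀⟩ := exists_isIsogenous_optimalDatum_of_modularity hnf W
      haveI := hW₀e
      haveI := hW₀m
      have hr₀ : W₀.analyticRank = 1 := by rw [← analyticRank_eq_of_isIsogenous' hiso, hr1]
      have hgood₀ : Good W₀ 3 := (hiso.hasGoodReductionAtPrime_iff 3).mp hord.1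
      have hord₀ : GoodOrd W₀ 3 := ⟨hgood₀, (hiso.not_dvd_frobeniusTrace_iff 3 hord.1).mp hord.2⟩
      have hsurj₀ : Surj W₀ 3 := (GaloisImage.surj_iff_of_isIsogenous_of_irr hiso hirr).mp hsurj
      have him₀ : BigIm W₀ 3 := X9.bigIm_three_of_surj W₀ hW20 (Or.inl hord₀.1) hsurj₀
      have hB₀ : BSDp W₀ 3 := by
        refine bsdp_rankOne_of_thm331_of_columnMainConjecture_odd_of_kolyvaginOrJetchev hGZ hKo hB hJ
          h331 hGr hGZK hmod hpar hnf hHL hMaz hNS W₀ 3 le_rfl hord₀ hsurj₀ hr₀ (fun _ ↦ hopt₀)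
          (fun htp₀ ↦ htam11 W₀ hiso hopt₀ htp₀)
          (fun V _ _ hordV hirrV himV ↦ hYZ V 3 le_rfl hordV hirrV himV)
          (fun V _ _ hordV hsV ↦ X9.bigIm_three_of_surj V hW20 (Or.inl hordV.1) hsV)
          (fun K _ _ hK _ _ ↦ irrK_of_surj W₀ 3 hsurj₀ K hK.1) ?_
        intro N _ K _ _ Dt H ιC P hN hK hodd hlt hHN hHp _ hP hc hPinf κ hκ γ _ ι
        exact X11b.imcLowerWaldspurgerOnTreeGoodAt_inducedPlace_of_heegner_of_thm412_of_thm331 W₀ 3 N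
          K Dt H ιC P h412 h331 (hKo N W₀ K) le_rfl hord₀ him₀ (irrK_of_surj W₀ 3 hsurj₀ K hK.1) hN
          hK hodd hlt hHN hHp hP hc hPinf hκ ι
      exact Additive.TwistComparison.bsdp_of_bsdp_of_isIsogenous W₀ W 3 hCassels hGZK hmod
        hiso.symm_of_charZero hr₀.le hB₀
  · exact RowC16.bsdp_of_publishedFacts W p hGZ hKo hB hYZ hW20 h331 h412 hGr hGZK hmod hpar hnf hHL
      hMaz hNS h hr fun _ ↦ htp

/-- **Row C3 (= JSW 2017 Thm. 1.2.1) at every prime of the row FROM PUBLISHED NAMED FACTS on the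
ordinary branch, Tamagawa binder read on the OPTIMAL CURVE of the class.** Off
`GoodOrd ∧ p ∣ ∏c_ℓ(E)`: gen 7's `RowC3.bsdp_of_publishedFacts_of_kobayashiMainConjecture`
(supersingular branch: Kobayashi's signed main conjecture `hKMC`, OPEN in print, + BKO Cor. A.5). On
it: pass to the optimal curve `E₀ ∼ E` ((sur) for `E` from Diamond's refined Serre `RowC3.surj`,
transferred; good ordinary transferred), §1 for `E₀` with the column MC / (Im) / IMC ∘ BDP by cases
`p ≥ 5` (BCS) / `p = 3` (Yan–Zhu), Cassels back to `E`. [cite: Jetchev2008, Cor. 1.5 (p. 3)]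
[cite: JetchevSkinnerWan2017, Thm. 1.2.1, Thm. 3.3.1, §1 (p. 4), §7.4.1–7.4.2 (pp. 30–31)]
[cite: BurungaleCastellaSkinner2025, Thm. 1.1.2 (b), Thm. 1.2.4 (b)] [cite: YanZhu2024MainConjNonCM, Thm. 4.9, Thm. 4.12]
[cite: BurungaleKobayashiOta2023, App. A Cor. A.5] [cite: MilneADT2006, Thm. I.7.3] [cite: Miller2011LMS, Def. 1.1] -/
theorem RowC3.bsdp_of_publishedFacts_of_kobayashiMainConjecture_of_jetchev_optimalCurve
    (hGZ : ∀ (N : ℕ) [NeZero N] (W : WeierstrassCurve ℚ) (K : Type) [Field K] [NumberField K],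
      gross_zagier N W K)
    (hKo : ∀ (N : ℕ) [NeZero N] (W : WeierstrassCurve ℚ) (K : Type) [Field K] [NumberField K],
      kolyvagin N W K)
    (hB : ∀ (N : ℕ) [NeZero N] (W : WeierstrassCurve ℚ) (K : Type) [Field K] [NumberField K],
      Kolyvagin1990_padicValNat_card_sha_le N W K)
    (hJ : Jetchev2008.cor15_padicValNat_card_primaryComponent_sha_le)
    (hBCS : thm112b_charIdeal_eq_padicLFunction_integral)
    (hYZ : thm49_charIdeal_eq_padicLFunction_integral)
    (hW20 : Wuthrich2014.lemma20_surjective_threeAdic_of_semistable)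
    (h331 : thm331_anticyclotomicControl) (h124 : thm124b_thm513_generator_constantCoeff)
    (h412 : thm412_thm513_generator_constantCoeff)
    (hA5 : corA5_pPart_of_signedCharIdeal_eq)
    (hGr : greenberg_charValue_rankZero) (hGZK : rank_eq_analyticRank_of_analyticRank_le_one)
    (hmod : hasEntireLFunction_rat) (hpar : nonempty_modularParametrizationData)
    (hnf : exists_isNewformOf) (hLL : diamond1995_refinedSerre)
    (hHL : HoffsteinLuo1997_exists_twist_L_one_ne_zero)
    (hMaz : mazur_not_dvd_maninConstant_of_odd) (hNS : integral_neronScaling_of_isGloballyMinimal)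
    (hCassels : bsdRHS_eq_of_isIsogenous)
    (h : RowC3 W p)
    (htam1 : GoodOrd W p → p ∣ W.tamagawaProduct →
      ∀ (W₀ : WeierstrassCurve ℚ) [W₀.IsElliptic] [W₀.IsGloballyMinimal], W.IsIsogenous W₀ →
        (∀ (N : ℕ) [NeZero N], W₀.conductorNorm ℤ = N →
          ∃ Dt : ModularParametrizationData W₀ N,
            ∀ z ∈ Dt.L.lattice, ∃ w ∈ periodLattice Dt.f, z = (Dt.c : ℂ) * w) →
        p ∣ W₀.tamagawaProduct → ∃ (q : ℕ) (_ : Fact q.Prime), q ∣ W₀.conductorNorm ℤ ∧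
          padicValNat p W₀.tamagawaProduct ≤
            padicValNat p ((W₀.baseChange ℚ_[q]).localTamagawaNumber ℤ_[q]))
    (ε : ℤˣ) (hKMC : (p : ℤ) ∣ W.frobeniusTrace p → Supersingular.KobayashiMainConjecture W p ε) :
    BSDp W p := by
  by_cases hJet : GoodOrd W p ∧ p ∣ W.tamagawaProduct
  · obtain ⟨hord, htp⟩ := hJet
    have hsurj : Surj W p := RowC3.surj hnf hLL h
    have hp : 5 ≤ p ∨ p = 3 ∧ (GoodOrd W p ∨ W.frobeniusTrace 3 = 0) := h.2.2.2.2
    have hp3 : 3 ≤ p := by rcases hp with h5 | ⟨h3, -⟩ <;> omega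
    -- the optimal curve of the class and the transfers
    obtain ⟨W₀, hW₀e, hW₀m, hiso, -, hopt₀⟩ := exists_isIsogenous_optimalDatum_of_modularity hnf W
    haveI := hW₀e
    haveI := hW₀m
    have hr₀ : W₀.analyticRank = 1 := by rw [← analyticRank_eq_of_isIsogenous' hiso, h.1]
    have hgood₀ : Good W₀ p := (hiso.hasGoodReductionAtPrime_iff p).mp hord.1
    have hord₀ : GoodOrd W₀ p := ⟨hgood₀, (hiso.not_dvd_frobeniusTrace_iff p hord.1).mp hord.2⟩
    have hsurj₀ : Surj W₀ p := (GaloisImage.surj_iff_of_isIsogenous_of_irr hiso h.2.2.2.1).mp hsurj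
    have hB₀ : BSDp W₀ p := by
      refine bsdp_rankOne_of_thm331_of_columnMainConjecture_odd_of_kolyvaginOrJetchev hGZ hKo hB hJ
        h331 hGr hGZK hmod hpar hnf hHL hMaz hNS W₀ p hp3 hord₀ hsurj₀ hr₀ (fun _ ↦ hopt₀)
        (fun htp₀ ↦ htam1 hord htp W₀ hiso hopt₀ htp₀) ?_ ?_
        (fun K _ _ hK _ _ ↦ irrK_of_surj W₀ p hsurj₀ K hK.1) ?_
      · intro V _ _ hordV hirrV himV
        by_cases h5 : 5 ≤ p
        · exact hBCS V p (by omega) hordV hirrV himV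
        · have h3 : p = 3 := by rcases hp with h | ⟨h, -⟩ <;> omega
          subst h3
          exact hYZ V 3 le_rfl hordV hirrV himV
      · intro V _ _ hordV hsV
        by_cases h5 : 5 ≤ p
        · exact X9.bigIm_of_surj V p h5 hsV
        · have h3 : p = 3 := by rcases hp with h | ⟨h, -⟩ <;> omega
          subst h3
          exact X9.bigIm_three_of_surj V hW20 (Or.inl hordV.1) hsV
      · intro N _ K _ _ Dt H ιC P hN hK hodd hlt hHN hHp _ hP hc hPinf κ hκ γ _ ι
        by_cases h5 : 5 ≤ p
        · exact X11b.imcLowerWaldspurgerOnTreeGoodAt_inducedPlace_of_heegner_of_thm124b_of_thm331 W₀ p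
            N K Dt H ιC P h124 h331 (hKo N W₀ K) (by omega) hord₀ hsurj₀
            (irrK_of_surj W₀ p hsurj₀ K hK.1) hN hK hodd hlt hHN hHp hP hc hPinf hκ ι
        · have h3 : p = 3 := by rcases hp with h | ⟨h, -⟩ <;> omega
          subst h3
          exact X11b.imcLowerWaldspurgerOnTreeGoodAt_inducedPlace_of_heegner_of_thm412_of_thm331 W₀ 3
            N K Dt H ιC P h412 h331 (hKo N W₀ K) le_rfl hord₀
            (X9.bigIm_three_of_surj W₀ hW20 (Or.inl hord₀.1) hsurj₀) (irrK_of_surj W₀ 3 hsurj₀ K hK.1)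
            hN hK hodd hlt hHN hHp hP hc hPinf hκ ι
    exact Additive.TwistComparison.bsdp_of_bsdp_of_isIsogenous W₀ W p hCassels hGZK hmod
      hiso.symm_of_charZero hr₀.le hB₀
  · exact RowC3.bsdp_of_publishedFacts_of_kobayashiMainConjecture W p hGZ hKo hB hBCS hYZ hW20 h331
      h124 h412 hA5 hGr hGZK hmod hpar hnf hLL hHL hMaz hNS h (fun hord htp ↦ hJet ⟨hord, htp⟩) ε hKMC

end Rows

end Summit.BirchSwinnertonDyer.Rank1Residual

end
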